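import Literature.Probability.Percolation.ArmSeparationIntRSW
import HarnessLib

/-!
# RSW for the inner half-annulus at a general density `p`: an open crossing of `intDom m` is not certain

Topic: Probability / Percolation; family `crit-perc` / near-critical percolation on `𝕋`
(`P_p = triSitePercolation p`, ANY `p : unitInterval`). `ArmSeparationIntRSW.lean` proves Nolin's
(4.16)–(4.17) (EJP 13 (2008), §4.4, proof of Lemma 15 [arXiv 0711.4948: Lemma 14]) for the
exploration domain `HalfAnnulus.intDom m` of the INTERNAL extremities — "the probability of
crossing this domain is less than some `1 - δ'` (by RSW)", and with BK `P(≥ h crossings) ≤ (1 - δ')^h`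
— at `p = 1/2`, where the closed blocking "C" (`intBlock m k`, five long-way crossings of
parallelograms of aspect ratio `≤ 24` realised by CLOSED sites) has the probability of its open
version by colour symmetry. Nolin's separation theorem is uniform in `p` below `L(p)` (Thm. 11
[arXiv Thm. 10]); at a general `p` the closed "C" of `P_p` is the open "C" of `P_{1-p}`
(`sitePercolation_real_preimage_compl`), so the RSW input is needed at the dual density `σ p = 1 - p`,
at the single height `k = ⌊m/8⌋` and widths `≤ 24 k`. This file re-runs the three probabilistic
statements of `ArmSeparationIntRSW.lean` accordingly (deterministic core `not_mem_crossEvent_intDom`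
imported):

* `pow_five_le_real_compl_preimage_intBlock_at` — `c⁵ ≤ P_p(ωᶜ ∈ intBlock m k)` from
  `c ≤ P_{1-p}(LR(L, k))` for all `L ≤ 24k` (Harris at `1 - p`);
* `real_crossEvent_intDom_le_at` — `P_p((intDom m).crossEvent) ≤ 1 - c⁵` (`m ≥ 8`, `k = ⌊m/8⌋`);
* `real_lowestSeq_intDom_ne_none_le_at` — `P_p(lowestSeq T ≠ none) ≤ (1 - c⁵)^{T+1}` (BK at `p`,
  `JDomain.real_lowestSeq_ne_none_le_pow`, already stated for every `p`).

Everything here is proved; no named facts are introduced.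

## References

* P. Nolin, *Near-critical percolation in two dimensions*, Electron. J. Probab. 13 (2008), Thm. 11,
  §4.4 Lemma 15 (proof) [arXiv 0711.4948: Thm. 10, Lemma 14, (4.16)–(4.17)]. [Nolin2008]
* H. Kesten, *Scaling relations for 2D-percolation*, Comm. Math. Phys. 109 (1987), Lemma 2. [Kesten1987]

Tree: `HalfAnnulus.intBlock`, `intBlockFinset`, `determinedBy_intBlock`, `not_mem_crossEvent_intDom`
(`ArmSeparationIntRSW.lean`); `HalfAnnulus.intDom`, `intDom_cutProp` (`TriHalfAnnulus.lean`);
`JDomain.real_lowestSeq_ne_none_le_pow` (`TriLowestCrossingProb.lean`); `sitePercolation_harris`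
(`SitePercolationMeasure.lean`); `sitePercolation_real_preimage_compl` (`TriHexLemma.lean`);
`triSitePercolation_real_triHCross/VCross`, `triLRCrossingProb_anti_width` (`TriRSWChaining.lean`).
-/

noncomputable section

open MeasureTheory Set
open scoped unitInterval

namespace Literature.Probability.Percolation

open LatticeModels

namespace HalfAnnulus

variable {m k : ℕ}

/-- **RSW and Harris for the closed "C" at density `p`**: if `c ≤ P_{1-p}(LR(L, k))` for every
width `L ≤ 24k` (`c ≥ 0`), then `P_p(ωᶜ ∈ intBlock m k) ≥ c⁵` for `m ≤ 16k` (the closed sites of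
`P_p` have the law of the open sites of `P_{1-p}`; the five parallelograms have height `k` — resp.
width `k` for the vertical ones — and aspect ratio at most `24`; Harris' inequality at `1 - p`). [cite: Nolin2008, §4.4 Lemma 15 (proof) (arXiv 0711.4948: Lemma 14, (4.16)), with Thm. 11 "uniformly in p"] -/
theorem pow_five_le_real_compl_preimage_intBlock_at (p : unitInterval) {c : ℝ}
    (hcw : ∀ L : ℕ, L ≤ 24 * k → c ≤ triLRCrossingProb (σ p) L k)
    (hc : 0 ≤ c) (hm : m ≤ 16 * k) :
    c ^ 5 ≤ (triSitePercolation p).real (compl ⁻¹' intBlock m k) := by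
  -- the five events, their supports, monotonicity and probabilities
  set E1 := triVCross ((m : ℤ) - 2 * k) (-(m : ℤ) - 2 * k) k (3 * k) with hE1
  set E2 := triHCross ((m : ℤ) - 2 * k) (-(m : ℤ) - 2 * k) (4 * k) k with hE2
  set E3 := triVCross ((m : ℤ) + k) (-(m : ℤ) - 2 * k) k (m + 8 * k) with hE3
  set E4 := triHCross ((m : ℤ) - 4 * k) (5 * k) (6 * k) k with hE4
  set E5 := triVCross ((m : ℤ) - 4 * k) (3 * k) k (3 * k) with hE5
  set F := intBlockFinset m k with hF
  have c1 : (↑(triStripFinset ((m : ℤ) - 2 * k) (-(m : ℤ) - 2 * k) k (3 * k)) : Set (Site 2)) ⊆ ↑F :=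
    Finset.coe_subset.2 (Finset.subset_union_left.trans (Finset.subset_union_left.trans
      (Finset.subset_union_left.trans Finset.subset_union_left)))
  have c2 : (↑(triStripFinset ((m : ℤ) - 2 * k) (-(m : ℤ) - 2 * k) (4 * k) k) : Set (Site 2)) ⊆ ↑F :=
    Finset.coe_subset.2 (Finset.subset_union_right.trans (Finset.subset_union_left.trans
      (Finset.subset_union_left.trans Finset.subset_union_left)))
  have c3 : (↑(triStripFinset ((m : ℤ) + k) (-(m : ℤ) - 2 * k) k (m + 8 * k)) : Set (Site 2)) ⊆ ↑F :=
    Finset.coe_subset.2 (Finset.subset_union_right.trans (Finset.subset_union_left.trans Finset.subset_union_left))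
  have c4 : (↑(triStripFinset ((m : ℤ) - 4 * k) (5 * k) (6 * k) k) : Set (Site 2)) ⊆ ↑F :=
    Finset.coe_subset.2 (Finset.subset_union_right.trans Finset.subset_union_left)
  have c5 : (↑(triStripFinset ((m : ℤ) - 4 * k) (3 * k) k (3 * k)) : Set (Site 2)) ⊆ ↑F :=
    Finset.coe_subset.2 (Finset.subset_union_right)
  have d1 : DeterminedBy E1 ↑F := (determinedBy_triVCross _ _ _ _).mono c1
  have d2 : DeterminedBy E2 ↑F := (determinedBy_triHCross _ _ _ _).mono c2
  have d3 : DeterminedBy E3 ↑F := (determinedBy_triVCross _ _ _ _).mono c3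
  have d4 : DeterminedBy E4 ↑F := (determinedBy_triHCross _ _ _ _).mono c4
  have d5 : DeterminedBy E5 ↑F := (determinedBy_triVCross _ _ _ _).mono c5
  have u1 : IsUpperSet E1 := isUpperSet_triVCross _ _ _ _
  have u2 : IsUpperSet E2 := isUpperSet_triHCross _ _ _ _
  have u3 : IsUpperSet E3 := isUpperSet_triVCross _ _ _ _
  have u4 : IsUpperSet E4 := isUpperSet_triHCross _ _ _ _
  have u5 : IsUpperSet E5 := isUpperSet_triVCross _ _ _ _
  have e1 : c ≤ (triSitePercolation (σ p)).real E1 := by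
    rw [hE1, triSitePercolation_real_triVCross]; exact hcw _ (by omega)
  have e2 : c ≤ (triSitePercolation (σ p)).real E2 := by
    rw [hE2, triSitePercolation_real_triHCross]; exact hcw _ (by omega)
  have e3 : c ≤ (triSitePercolation (σ p)).real E3 := by
    rw [hE3, triSitePercolation_real_triVCross]; exact hcw _ (by omega)
  have e4 : c ≤ (triSitePercolation (σ p)).real E4 := by
    rw [hE4, triSitePercolation_real_triHCross]; exact hcw _ (by omega)
  have e5 : c ≤ (triSitePercolation (σ p)).real E5 := by
    rw [hE5, triSitePercolation_real_triVCross]; exact hcw _ (by omega)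
  have hblock : intBlock m k = E1 ∩ E2 ∩ E3 ∩ E4 ∩ E5 := rfl
  unfold triSitePercolation at e1 e2 e3 e4 e5 ⊢
  rw [sitePercolation_real_preimage_compl, hblock]
  have h12 := sitePercolation_harris (σ p) d1 d2 u1 u2
  have h123 := sitePercolation_harris (σ p) (d1.inter d2) d3 (u1.inter u2) u3
  have h1234 := sitePercolation_harris (σ p) ((d1.inter d2).inter d3) d4 ((u1.inter u2).inter u3) u4
  have h12345 := sitePercolation_harris (σ p) (((d1.inter d2).inter d3).inter d4) d5
    (((u1.inter u2).inter u3).inter u4) u5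
  set μ := sitePercolation (Site 2) (σ p) with hμ
  calc c ^ 5 = c * c * c * c * c := by ring
    _ ≤ μ.real E1 * μ.real E2 * μ.real E3 * μ.real E4 * μ.real E5 := by
        have := mul_le_mul e1 e2 hc measureReal_nonneg
        have := mul_le_mul this e3 hc (mul_nonneg measureReal_nonneg measureReal_nonneg)
        have := mul_le_mul this e4 hc (mul_nonneg (mul_nonneg measureReal_nonneg measureReal_nonneg) measureReal_nonneg)
        exact mul_le_mul this e5 hc (mul_nonneg (mul_nonneg (mul_nonneg measureReal_nonneg measureReal_nonneg)
          measureReal_nonneg) measureReal_nonneg)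
    _ ≤ μ.real (E1 ∩ E2) * μ.real E3 * μ.real E4 * μ.real E5 :=
        mul_le_mul_of_nonneg_right (mul_le_mul_of_nonneg_right (mul_le_mul_of_nonneg_right h12
          measureReal_nonneg) measureReal_nonneg) measureReal_nonneg
    _ ≤ μ.real (E1 ∩ E2 ∩ E3) * μ.real E4 * μ.real E5 :=
        mul_le_mul_of_nonneg_right (mul_le_mul_of_nonneg_right h123 measureReal_nonneg) measureReal_nonneg
    _ ≤ μ.real (E1 ∩ E2 ∩ E3 ∩ E4) * μ.real E5 := mul_le_mul_of_nonneg_right h1234 measureReal_nonneg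
    _ ≤ μ.real (E1 ∩ E2 ∩ E3 ∩ E4 ∩ E5) := h12345

/-- **Nolin's (4.16) for the inner half-annulus at density `p`**: if `c ≤ P_{1-p}(LR(L, k))` for
`k = ⌊m/8⌋` and all `L ≤ 24k` (`c ≥ 0`, `m ≥ 8`), then `P_p((intDom m).crossEvent) ≤ 1 - c⁵`
(the closed "C" at scale `k`, `8k ≤ m ≤ 16k`, forbids every open crossing,
`not_mem_crossEvent_intDom`). [cite: Nolin2008, §4.4 Lemma 15 (proof) (arXiv 0711.4948: Lemma 14, (4.16)), with Thm. 11 "uniformly in p"] -/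
theorem real_crossEvent_intDom_le_at (p : unitInterval) {c : ℝ} (hm : 8 ≤ m)
    (hcw : ∀ L : ℕ, L ≤ 24 * (m / 8) → c ≤ triLRCrossingProb (σ p) L (m / 8)) (hc : 0 ≤ c) :
    (triSitePercolation p).real (intDom m).crossEvent ≤ 1 - c ^ 5 := by
  set k := m / 8 with hk
  have hk1 : 1 ≤ k := by omega
  have hkm : 8 * k ≤ m := by omega
  have hmk : m ≤ 16 * k := by omega
  have hmeas : MeasurableSet (compl ⁻¹' intBlock m k) :=
    (determinedBy_compl_mem (determinedBy_intBlock m k)).measurableSet_of_finset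
  have hsub : (intDom m).crossEvent ⊆ (compl ⁻¹' intBlock m k)ᶜ := fun ω hω hωV =>
    not_mem_crossEvent_intDom hk1 hkm hωV hω
  have h5 := pow_five_le_real_compl_preimage_intBlock_at p hcw hc hmk
  calc (triSitePercolation p).real (intDom m).crossEvent
      ≤ (triSitePercolation p).real (compl ⁻¹' intBlock m k)ᶜ := measureReal_mono hsub
    _ = 1 - (triSitePercolation p).real (compl ⁻¹' intBlock m k) := by
        rw [measureReal_compl hmeas, probReal_univ]
    _ ≤ 1 - c ^ 5 := by linarith

/-- **Nolin's (4.17) for the inner half-annulus at density `p`**: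
`P_p(lowestSeq T ≠ none) ≤ (1 - c⁵)^{T+1}` for the exploration sequence of `intDom m`, `m ≥ 8`,
given `c ≤ P_{1-p}(LR(L, ⌊m/8⌋))` for all `L ≤ 24 ⌊m/8⌋` (BK for the product measure `P_p`,
`JDomain.real_lowestSeq_ne_none_le_pow`, and `real_crossEvent_intDom_le_at`). [cite: Nolin2008, §4.4 Lemma 15 (proof) (arXiv 0711.4948: Lemma 14, (4.17)), with Thm. 11 "uniformly in p"] -/
theorem real_lowestSeq_intDom_ne_none_le_at (p : unitInterval) {c : ℝ} (hm : 8 ≤ m)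
    (hcw : ∀ L : ℕ, L ≤ 24 * (m / 8) → c ≤ triLRCrossingProb (σ p) L (m / 8)) (hc : 0 ≤ c) (T : ℕ) :
    (triSitePercolation p).real {ω | (intDom m).lowestSeq ω T ≠ none} ≤ (1 - c ^ 5) ^ (T + 1) := by
  have h1 := JDomain.real_lowestSeq_ne_none_le_pow (intDom_cutProp (m := m) (by omega)) p T
  have h2 := real_crossEvent_intDom_le_at p hm hcw hc
  unfold triSitePercolation at h2 ⊢
  exact h1.trans (pow_le_pow_left₀ measureReal_nonneg h2 _)

end HalfAnnulus

end Literature.Probability.Percolation
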